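import Literature.Topology.FourManifolds.TautFoliationsFillFoliated
import Literature.Topology.FourManifolds.TautFoliationsConeCorners
import Literature.Topology.FourManifolds.TautFoliationsHolonomyCocycle
import Literature.Topology.PlanarFoliations.Punctures
import HarnessLib

/-!
# The contour foliation of a disc in cone position has puncture data

Topic: assembly of `TautFoliationsFillFoliated` (the filled map of a disc in checkerboard cone
position is a foliated map from the bi-oriented contour foliation of the punctured open square
`X₀` to `F`) with `PlanarFoliations.Punctures` (the abstract setting of a planar foliation with
finitely many isolated singularities induced by a map). We construct
`ConePosition.punctureData : PunctureData (P.contourFol ho) P.gr.planeEmb F (fill ∘ (re, im))`: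
the region is the open big square, the punctures are the centres and the interior vertices of
the grid, the flow box at a puncture `v` is the box of a grid square containing `v` (the
squares at an interior vertex are pairwise adjacent, so the filled map sends a neighbourhood
of `v` into that box), and the **finiteness of the level leaves** is the local analysis of the
cone: at a centre there is no point at the apex level (`coneHt_lt_apex`), at a vertex the
points at the level of the vertex lie on at most eight corner arcs (`TautFoliationsConeCorners`:
two per square at the vertex, admissible or not according to the tame behaviour of the
boundary height along the edge), each of which runs in one leaf (it is continuous with
constant box height, hence leafwise by `IsFoliatedMap.continuous_toLeafSpace_of_comp`).

* `IsFoliatedMap.continuous_toLeafSpace_of_comp` (**proved**): a foliated map reflects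
  leafwise continuity.
* `Foliation.eventually_height_eq_transition` (**proved**): near a common point of two flow
  boxes, the height in the second is the transition germ applied to the height in the first.
* grid lattice lemmas (`Grid.exists_nat_of_mem_punct`, `Grid.le_dist_of_mem_punct`: distinct
  punctures are `ℓ` apart; `Grid.exists_sq_of_mem_vertices`, `Grid.mem_sq_of_quadrant`,
  `Grid.exists_cornerEdge_eq_edge`) (**proved**).
* `ConePosition.height_fill_eq_coneHt`, `exists_tame_cornerEdge` (tameness of the boundary
  height along the edges from a corner, from `skel_tame`), `arc` (the corner arcs of a square),
  `exists_arc_dichotomy`, `exists_eq_arc`, `arc_mem_leaf` (the arcs are leafwise),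
  `exists_cover_corner`, `height_ne_of_mem_centres`, `exists_cover_vertex` (four squares and
  the height transitions to one box), `exists_localData` (**proved**).
* `ConePosition.fillC`, `ConePosition.Ω`, `ConePosition.punct`, `ConePosition.punctureData`
  (**definitions**; all fields of the puncture data **proved**).

All statements are [folklore].
-/

noncomputable section

open Set Filter Metric Topology Function
open Literature.Topology.PlanarFoliations

namespace Literature.Topology.FourManifolds

/-! ## A foliated map reflects leafwise continuity -/

namespace Foliation

section Reflect

variable {B : Type*} [TopologicalSpace B] {M : Type*} [TopologicalSpace M]
variable {B' : Type*} [TopologicalSpace B'] {X : Type*} [TopologicalSpace X]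
variable {F' : Foliation B' X} {F : Foliation B M} {f : X → M}

/-- **A foliated map reflects leafwise continuity**: if `γ` is continuous and `f ∘ γ` is
continuous into the leaf space of `F`, then `γ` is continuous into the leaf space of `F'` (the
heights of the charts of `F'` are homeomorphism germs of heights of charts of `F` composed with
`f`). [folklore] -/
theorem IsFoliatedMap.continuousAt_toLeafSpace_of_comp (hf : IsFoliatedMap F' F f) {A : Type*} [TopologicalSpace A]
    {γ : A → X} {a : A} (hγ : ContinuousAt γ a) (hfγ : ContinuousAt (toLeafSpace ∘ (f ∘ γ) : A → F.LeafSpace) a) :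
    ContinuousAt (toLeafSpace ∘ γ : A → F'.LeafSpace) a := by
  obtain ⟨c, hc, hxc, e, he, hxe, φ, -, hcomp⟩ := hf.compat (γ a)
  have h₁ : ∀ᶠ b in 𝓝 a, (e (f (γ b))).2 = (e (f (γ a))).2 := F.eventually_height_eq_of_continuousAt hfγ he hxe
  have h₂ : ∀ᶠ b in 𝓝 a, height c (γ b) = (φ ∘ height e ∘ f) (γ b) := hγ.eventually hcomp
  have h₀ : height c (γ a) = (φ ∘ height e ∘ f) (γ a) := hcomp.self_of_nhds
  refine F'.continuousAt_toLeafSpace_comp hγ hc hxc ?_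
  filter_upwards [h₁, h₂] with b hb₁ hb₂
  show height c (γ b) = height c (γ a)
  rw [hb₂, h₀]
  show φ (e (f (γ b))).2 = φ (e (f (γ a))).2
  rw [hb₁]

/-- **A foliated map reflects leafwise continuity** (global version). [folklore] -/
theorem IsFoliatedMap.continuous_toLeafSpace_of_comp (hf : IsFoliatedMap F' F f) {A : Type*} [TopologicalSpace A]
    {γ : A → X} (hγ : Continuous γ) (hfγ : Continuous (toLeafSpace ∘ (f ∘ γ) : A → F.LeafSpace)) :
    Continuous (toLeafSpace ∘ γ : A → F'.LeafSpace) :=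
  continuous_iff_continuousAt.2 fun _ ↦ hf.continuousAt_toLeafSpace_of_comp hγ.continuousAt hfγ.continuousAt

end Reflect

/-! ## Heights in two flow boxes near a common point -/

section Transition

variable {B : Type*} [NormedAddCommGroup B] {M : Type*} [TopologicalSpace M] (F : Foliation B M)
variable {e e' : OpenPartialHomeomorph M (B × ℝ)} {z : M}

/-- **Near a common point of two flow boxes, the height in the second box is the transition germ
applied to the height in the first.** [folklore] -/
theorem eventually_height_eq_transition (he : e ∈ F.atlas) (he' : e' ∈ F.atlas) (hz : z ∈ e.source)
    (hz' : z ∈ e'.source) : ∀ᶠ w in 𝓝 z, height e' w = transition e e' z (height e w) := by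
  obtain ⟨U, hU, hUe⟩ := F.locally_plaque e he e' he' z ⟨hz, hz'⟩
  obtain ⟨O, hOU, hOo, hzO⟩ := mem_nhds_iff.1 hU
  -- the vertical through `z` runs in `O ∩ e'.source` for heights near `(e z).2`
  have hv : ∀ᶠ τ in 𝓝 (e z).2, vertical e (e z).1 τ ∈ O ∩ e'.source :=
    F.eventually_vertical_mem he hz (inter_mem (hOo.mem_nhds hzO) (e'.open_source.mem_nhds hz'))
  -- the height of `w` is near `(e z).2` for `w` near `z`
  have hh : ContinuousAt (fun w ↦ (e w).2) z := continuous_snd.continuousAt.comp (e.continuousAt hz)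
  filter_upwards [hh.preimage_mem_nhds hv, hOo.mem_nhds hzO, e.open_source.mem_nhds hz, e'.open_source.mem_nhds hz']
    with w hw hwO hwe hwe'
  obtain ⟨hvO, hve'⟩ : vertical e (e z).1 (e w).2 ∈ O ∩ e'.source := hw
  rw [transition_apply]
  refine hUe w ⟨hOU hwO, hwe, hwe'⟩ _ ⟨hOU hvO, F.vertical_mem_source he _ _, hve'⟩ ?_
  rw [F.apply_vertical he]
  rfl

end Transition

end Foliation

/-! ## The lattice of centres and vertices -/

namespace SquareGrid.Grid

variable (g : Grid)

/-- The punctures (centres and vertices) are lattice points `a + ℓ (k, k')`. [folklore] -/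
theorem exists_nat_of_mem_punct {x : ℝ × ℝ} (hx : x ∈ g.centres ∪ g.vertices) :
    ∃ k k' : ℕ, x = (g.a.1 + k * g.ℓ, g.a.2 + k' * g.ℓ) := by
  rcases hx with ⟨q, rfl⟩ | ⟨p, -, rfl⟩
  · exact ⟨2 * q.1 + 1, 2 * q.2 + 1, by rw [centre]; push_cast; ring_nf⟩
  · exact ⟨2 * p.1, 2 * p.2, by push_cast; ring_nf⟩

/-- **Distinct punctures are at least `ℓ` apart.** [folklore] -/
theorem le_dist_of_mem_punct {x y : ℝ × ℝ} (hx : x ∈ g.centres ∪ g.vertices) (hy : y ∈ g.centres ∪ g.vertices)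
    (hne : x ≠ y) : g.ℓ ≤ dist x y := by
  have hℓ := g.hℓ
  obtain ⟨k, k', rfl⟩ := g.exists_nat_of_mem_punct hx
  obtain ⟨m, m', rfl⟩ := g.exists_nat_of_mem_punct hy
  rw [Prod.dist_eq, Real.dist_eq, Real.dist_eq]
  simp only [add_sub_add_left_eq_sub, ← sub_mul, abs_mul, abs_of_pos hℓ]
  have hkm : k ≠ m ∨ k' ≠ m' := by
    by_contra h
    push Not at h
    exact hne (by rw [h.1, h.2])
  have key : ∀ {a b : ℕ}, a ≠ b → (1 : ℝ) ≤ |(a : ℝ) - b| := fun {a b} hab ↦ by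
    rcases Nat.lt_or_gt_of_ne hab with h | h
    · have : (a : ℝ) + 1 ≤ b := by exact_mod_cast h
      rw [abs_of_neg (by linarith)]; linarith
    · have : (b : ℝ) + 1 ≤ a := by exact_mod_cast h
      rw [abs_of_pos (by linarith)]; linarith
  rcases hkm with h | h
  · exact le_max_of_le_left (by nlinarith [key h])
  · exact le_max_of_le_right (by nlinarith [key h])

/-- **An interior vertex is the common corner of four squares**: for a vertex `v` in the open
big square and signs `σ₁, σ₂`, there is a square containing `v` with centre `v + ℓ (σ₁, σ₂)`;
it contains every point `y` with `σᵢ (yᵢ - vᵢ) ≥ 0` and `|yᵢ - vᵢ| ≤ 2ℓ`. [folklore] -/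
theorem exists_sq_of_mem_vertices {v : ℝ × ℝ} (hv : v ∈ g.vertices) (hvb : v ∈ ball g.bigCentre (g.n * g.ℓ))
    {σ₁ σ₂ : ℝ} (h₁ : ConeSquare.IsSign σ₁) (h₂ : ConeSquare.IsSign σ₂) :
    ∃ q : Fin g.n × Fin g.n, g.centre q = (v.1 + σ₁ * g.ℓ, v.2 + σ₂ * g.ℓ) := by
  have hℓ := g.hℓ
  obtain ⟨p, -, rfl⟩ := hv
  rw [mem_ball_bigCentre_iff] at hvb
  obtain ⟨hb₁, hb₂, hb₃, hb₄⟩ := hvb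
  simp only at hb₁ hb₂ hb₃ hb₄
  -- `0 < p.1 < n`, `0 < p.2 < n`
  have hp₁ : 0 < (p.1 : ℕ) := by
    by_contra h
    push Not at h
    have : ((p.1 : ℕ) : ℝ) = 0 := by exact_mod_cast Nat.le_zero.1 h
    rw [this] at hb₁; linarith
  have hp₁' : (p.1 : ℕ) < g.n := by
    by_contra h
    push Not at h
    have : (g.n : ℝ) ≤ (p.1 : ℕ) := by exact_mod_cast h
    nlinarith
  have hp₂ : 0 < (p.2 : ℕ) := by
    by_contra h
    push Not at h
    have : ((p.2 : ℕ) : ℝ) = 0 := by exact_mod_cast Nat.le_zero.1 h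
    rw [this] at hb₃; linarith
  have hp₂' : (p.2 : ℕ) < g.n := by
    by_contra h
    push Not at h
    have : (g.n : ℝ) ≤ (p.2 : ℕ) := by exact_mod_cast h
    nlinarith
  -- the indices of the square
  have hi : ∃ i : Fin g.n, (2 * (i : ℕ) + 1 : ℝ) * g.ℓ = 2 * (p.1 : ℕ) * g.ℓ + σ₁ * g.ℓ := by
    rcases h₁ with rfl | rfl
    · exact ⟨⟨p.1, hp₁'⟩, by push_cast; ring⟩
    · refine ⟨⟨(p.1 : ℕ) - 1, by omega⟩, ?_⟩
      have : (((p.1 : ℕ) - 1 : ℕ) : ℝ) = (p.1 : ℕ) - 1 := by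
        rw [Nat.cast_sub (by omega)]; push_cast; ring
      rw [show ((⟨(p.1 : ℕ) - 1, by omega⟩ : Fin g.n) : ℕ) = (p.1 : ℕ) - 1 from rfl, this]
      ring
  have hj : ∃ j : Fin g.n, (2 * (j : ℕ) + 1 : ℝ) * g.ℓ = 2 * (p.2 : ℕ) * g.ℓ + σ₂ * g.ℓ := by
    rcases h₂ with rfl | rfl
    · exact ⟨⟨p.2, hp₂'⟩, by push_cast; ring⟩
    · refine ⟨⟨(p.2 : ℕ) - 1, by omega⟩, ?_⟩
      have : (((p.2 : ℕ) - 1 : ℕ) : ℝ) = (p.2 : ℕ) - 1 := by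
        rw [Nat.cast_sub (by omega)]; push_cast; ring
      rw [show ((⟨(p.2 : ℕ) - 1, by omega⟩ : Fin g.n) : ℕ) = (p.2 : ℕ) - 1 from rfl, this]
      ring
  obtain ⟨i, hi⟩ := hi
  obtain ⟨j, hj⟩ := hj
  refine ⟨(i, j), ?_⟩
  rw [centre]
  ext <;> simp only <;> linarith

/-- Points of the quadrant of signs `(σ₁, σ₂)` at `v`, within `2ℓ`, lie in that square.
[folklore] -/
theorem mem_sq_of_quadrant {v y : ℝ × ℝ} {q : Fin g.n × Fin g.n} {σ₁ σ₂ : ℝ} (h₁ : ConeSquare.IsSign σ₁)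
    (h₂ : ConeSquare.IsSign σ₂) (hq : g.centre q = (v.1 + σ₁ * g.ℓ, v.2 + σ₂ * g.ℓ))
    (hy₁ : 0 ≤ σ₁ * (y.1 - v.1)) (hy₁' : |y.1 - v.1| ≤ 2 * g.ℓ) (hy₂ : 0 ≤ σ₂ * (y.2 - v.2))
    (hy₂' : |y.2 - v.2| ≤ 2 * g.ℓ) : y ∈ g.sq q := by
  have hℓ := g.hℓ
  rw [sq, mem_closedBall, Prod.dist_eq, hq, Real.dist_eq, Real.dist_eq, max_le_iff]
  simp only
  have hb₁ := abs_le.1 hy₁'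
  have hb₂ := abs_le.1 hy₂'
  constructor
  · rcases h₁ with rfl | rfl
    · rw [abs_le]; constructor <;> nlinarith
    · rw [abs_le]; constructor <;> nlinarith
  · rcases h₂ with rfl | rfl
    · rw [abs_le]; constructor <;> nlinarith
    · rw [abs_le]; constructor <;> nlinarith

/-- The vertex is a corner of that square: `v = corner (centre q) ℓ (-σ₁) (-σ₂)`. [folklore] -/
theorem eq_corner_of_centre_eq {v : ℝ × ℝ} {q : Fin g.n × Fin g.n} {σ₁ σ₂ : ℝ}
    (hq : g.centre q = (v.1 + σ₁ * g.ℓ, v.2 + σ₂ * g.ℓ)) : v = ConeSquare.corner (g.centre q) g.ℓ (-σ₁) (-σ₂) := by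
  rw [ConeSquare.corner, hq]
  ext <;> simp

/-- The vertex lies in that square. [folklore] -/
theorem mem_sq_of_centre_eq {v : ℝ × ℝ} {q : Fin g.n × Fin g.n} {σ₁ σ₂ : ℝ} (h₁ : ConeSquare.IsSign σ₁)
    (h₂ : ConeSquare.IsSign σ₂) (hq : g.centre q = (v.1 + σ₁ * g.ℓ, v.2 + σ₂ * g.ℓ)) : v ∈ g.sq q :=
  g.mem_sq_of_quadrant h₁ h₂ hq (by simp) (by simp [g.hℓ.le]) (by simp) (by simp [g.hℓ.le])

/-- **The corner edges are grid edges, traversed from the corner.** [folklore] -/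
theorem exists_cornerEdge_eq_edge (q : Fin g.n × Fin g.n) {s₁ s₂ : ℝ} (h₁ : ConeSquare.IsSign s₁) (h₂ : ConeSquare.IsSign s₂)
    (i : Bool) :
    ∃ k : Fin 4, (∀ t, ConeSquare.corner (g.centre q) g.ℓ s₁ s₂ + t • ConeSquare.cornerDir s₁ s₂ i = g.edge q k t) ∨
      (∀ t, ConeSquare.corner (g.centre q) g.ℓ s₁ s₂ + t • ConeSquare.cornerDir s₁ s₂ i = g.edge q k (2 * g.ℓ - t)) := by
  rcases h₁ with rfl | rfl <;> rcases h₂ with rfl | rfl <;> cases i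
  -- (1, 1): top-right corner: second edge = right edge reversed, first edge = top edge reversed
  · exact ⟨3, Or.inr fun t ↦ by
      ext <;> simp [ConeSquare.corner, ConeSquare.cornerDir, ConeSquare.cornerDir₂, centre_fst, centre_snd] <;> ring⟩
  · exact ⟨1, Or.inr fun t ↦ by
      ext <;> simp [ConeSquare.corner, ConeSquare.cornerDir, ConeSquare.cornerDir₁, centre_fst, centre_snd] <;> ring⟩
  -- (1, -1): bottom-right corner: second edge = right edge, first edge = bottom edge reversed
  · exact ⟨3, Or.inl fun t ↦ by
      ext <;> simp [ConeSquare.corner, ConeSquare.cornerDir, ConeSquare.cornerDir₂, centre_fst, centre_snd] <;> ring⟩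
  · exact ⟨0, Or.inr fun t ↦ by
      ext <;> simp [ConeSquare.corner, ConeSquare.cornerDir, ConeSquare.cornerDir₁, centre_fst, centre_snd] <;> ring⟩
  -- (-1, 1): top-left corner: second edge = left edge reversed, first edge = top edge
  · exact ⟨2, Or.inr fun t ↦ by
      ext <;> simp [ConeSquare.corner, ConeSquare.cornerDir, ConeSquare.cornerDir₂, centre_fst, centre_snd] <;> ring⟩
  · exact ⟨1, Or.inl fun t ↦ by
      ext <;> simp [ConeSquare.corner, ConeSquare.cornerDir, ConeSquare.cornerDir₁, centre_fst, centre_snd] <;> ring⟩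
  -- (-1, -1): bottom-left corner: second edge = left edge, first edge = bottom edge
  · exact ⟨2, Or.inl fun t ↦ by
      ext <;> simp [ConeSquare.corner, ConeSquare.cornerDir, ConeSquare.cornerDir₂, centre_fst, centre_snd] <;> ring⟩
  · exact ⟨0, Or.inl fun t ↦ by
      ext <;> simp [ConeSquare.corner, ConeSquare.cornerDir, ConeSquare.cornerDir₁, centre_fst, centre_snd] <;> ring⟩

end SquareGrid.Grid

/-! ## The cone position: heights, tameness along corner edges -/

namespace Foliation.ConePosition

open ConeSquare SquareGrid TameFunction

variable {B : Type*} [NormedAddCommGroup B] [NormedSpace ℝ B] {M : Type*} [TopologicalSpace M]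
  {F : Foliation B M} {f : ℝ × ℝ → M} {c₀ : ℝ × ℝ} {L : ℝ} {hL : 0 < L} (P : ConePosition F f c₀ hL)

/-- **The box height of the filled map is the cone height** over the boundary heights.
[folklore] -/
theorem height_fill_eq_coneHt {q : Fin P.n × Fin P.n} {x : ℝ × ℝ} (hx : x ∈ P.gr.sq q) :
    height (P.box q) (P.fill P.apex x) = coneHt (P.gr.centre q) P.gr.ℓ (P.apex q) (P.bdryHt q) x := by
  rw [P.height_fill hx, coneHt_apply]
  rfl

omit [NormedSpace ℝ B] in
/-- **The boundary height is tame along the corner edges, from the corner**: on an initial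
interval it is strictly monotone or constant. [folklore] -/
theorem exists_tame_cornerEdge (q : Fin P.n × Fin P.n) {s₁ s₂ : ℝ} (h₁ : IsSign s₁) (h₂ : IsSign s₂) (i : Bool) :
    ∃ δ > (0 : ℝ), δ ≤ 2 * P.gr.ℓ ∧
      (StrictMonoOn (fun t ↦ P.bdryHt q (corner (P.gr.centre q) P.gr.ℓ s₁ s₂ + t • cornerDir s₁ s₂ i)) (Icc 0 δ) ∨
       StrictAntiOn (fun t ↦ P.bdryHt q (corner (P.gr.centre q) P.gr.ℓ s₁ s₂ + t • cornerDir s₁ s₂ i)) (Icc 0 δ) ∨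
       ∀ t ∈ Icc 0 δ, P.bdryHt q (corner (P.gr.centre q) P.gr.ℓ s₁ s₂ + t • cornerDir s₁ s₂ i) =
         P.bdryHt q (corner (P.gr.centre q) P.gr.ℓ s₁ s₂ + (0 : ℝ) • cornerDir s₁ s₂ i)) := by
  have hℓ := P.gr.hℓ
  obtain ⟨k, hk⟩ := P.gr.exists_cornerEdge_eq_edge q h₁ h₂ i
  obtain ⟨-, hright, hleft⟩ := P.skel_tame q k
  set g : ℝ → ℝ := fun s ↦ height (P.box q) (P.skel (P.gr.edge q k s)) with hg
  have hg' : ∀ s, P.bdryHt q (P.gr.edge q k s) = g s := fun s ↦ rfl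
  rcases hk with hk | hk
  · -- traversed forwards: tameness on the right at `0`
    obtain ⟨δ₀, hδ₀, hof⟩ := (hright 0 ⟨le_rfl, by linarith⟩).of_le
    set δ := min δ₀ (2 * P.gr.ℓ) with hδ
    have hδpos : 0 < δ := lt_min hδ₀ (by linarith)
    refine ⟨δ, hδpos, min_le_right _ _, ?_⟩
    have h := hof δ hδpos (min_le_left _ _)
    simp only [zero_add] at h
    rcases h with h | h | h
    · exact Or.inl fun a ha b hb hab ↦ by simp only [hk, hg']; exact h ha hb hab
    · exact Or.inr (Or.inl fun a ha b hb hab ↦ by simp only [hk, hg']; exact h ha hb hab)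
    · exact Or.inr (Or.inr fun t ht ↦ by rw [hk, hk, hg', hg']; exact h t ht)
  · -- traversed backwards: tameness on the left at `2ℓ`
    obtain ⟨δ₀, hδ₀, hof⟩ := (hleft (2 * P.gr.ℓ) ⟨by linarith, le_rfl⟩).of_le
    set δ := min δ₀ (2 * P.gr.ℓ) with hδ
    have hδpos : 0 < δ := lt_min hδ₀ (by linarith)
    refine ⟨δ, hδpos, min_le_right _ _, ?_⟩
    have h := hof δ hδpos (min_le_left _ _)
    have hmem : ∀ {a}, a ∈ Icc 0 δ → 2 * P.gr.ℓ - a ∈ Icc (2 * P.gr.ℓ - δ) (2 * P.gr.ℓ) := fun {a} ha ↦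
      ⟨by linarith [ha.2], by linarith [ha.1]⟩
    rcases h with h | h | h
    · refine Or.inr (Or.inl fun a ha b hb hab ↦ ?_)
      simp only [hk, hg']
      exact h (hmem hb) (hmem ha) (by linarith)
    · refine Or.inl fun a ha b hb hab ↦ ?_
      simp only [hk, hg']
      exact h (hmem hb) (hmem ha) (by linarith)
    · exact Or.inr (Or.inr fun t ht ↦ by rw [hk, hk, hg', hg', sub_zero]; exact h _ (hmem ht))

/-! ## The corner arcs of a square at a vertex: uniform facts for roof and floor squares -/

section Corner

variable (ho : F.IsTransverselyOriented) (q : Fin P.n × Fin P.n) {s₁ s₂ : ℝ} (h₁ : IsSign s₁) (h₂ : IsSign s₂)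
include h₁ h₂

/-- The corner arc of the square `q` (apex `P.apex q`, boundary heights `P.bdryHt q`). [folklore] -/
def arc (i : Bool) (t : ℝ) : ℝ × ℝ := cornerArc (P.gr.centre q) P.gr.ℓ (P.apex q) (P.bdryHt q) s₁ s₂ i t

omit [NormedSpace ℝ B] h₁ h₂ in
/-- Unfolding lemma for `arc`. [folklore] -/
theorem arc_def (i : Bool) (t : ℝ) : P.arc q (s₁ := s₁) (s₂ := s₂) i t =
    cornerArc (P.gr.centre q) P.gr.ℓ (P.apex q) (P.bdryHt q) s₁ s₂ i t := rfl

omit [NormedSpace ℝ B] in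
/-- The corner arc starts at the corner. [folklore] -/
theorem arc_zero (i : Bool) : P.arc q (s₁ := s₁) (s₂ := s₂) i 0 = corner (P.gr.centre q) P.gr.ℓ s₁ s₂ := by
  by_cases hq : P.roofPat q
  · exact cornerArc_zero P.gr.hℓ (P.apex_spec.2.1 q hq) h₁ h₂ i
  · exact cornerArc_zero_floor P.gr.hℓ (P.apex_spec.2.2 q hq) h₁ h₂ i

omit [NormedSpace ℝ B] in
/-- The corner arc is continuous on `[0, 2ℓ]`. [folklore] -/
theorem continuousOn_arc (i : Bool) : ContinuousOn (P.arc q (s₁ := s₁) (s₂ := s₂) i) (Icc 0 (2 * P.gr.ℓ)) := by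
  by_cases hq : P.roofPat q
  · exact continuousOn_cornerArc P.gr.hℓ (P.apex_spec.2.1 q hq) h₁ h₂ (P.continuousOn_bdryHt q) i
  · exact continuousOn_cornerArc_floor P.gr.hℓ (P.apex_spec.2.2 q hq) h₁ h₂ (P.continuousOn_bdryHt q) i

omit [NormedSpace ℝ B] in
/-- The corner arc avoids the corner for positive parameters. [folklore] -/
theorem arc_ne_corner (i : Bool) {t : ℝ} (ht : t ∈ Ioc 0 (2 * P.gr.ℓ)) :
    P.arc q (s₁ := s₁) (s₂ := s₂) i t ≠ corner (P.gr.centre q) P.gr.ℓ s₁ s₂ := by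
  by_cases hq : P.roofPat q
  · exact cornerArc_ne_corner P.gr.hℓ (P.apex_spec.2.1 q hq) h₁ h₂ i ht
  · exact cornerArc_ne_corner_floor P.gr.hℓ (P.apex_spec.2.2 q hq) h₁ h₂ i ht

/-- **Along the corner arc inside the square, the box height of the filled map is the corner
height.** [folklore] -/
theorem height_fill_arc (i : Bool) {t : ℝ} (ht : t ∈ Icc 0 (2 * P.gr.ℓ)) (hmem : P.arc q (s₁ := s₁) (s₂ := s₂) i t ∈ P.gr.sq q) :
    height (P.box q) (P.fill P.apex (P.arc q (s₁ := s₁) (s₂ := s₂) i t)) =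
      P.bdryHt q (corner (P.gr.centre q) P.gr.ℓ s₁ s₂) := by
  rw [P.height_fill_eq_coneHt hmem, arc_def]
  by_cases hq : P.roofPat q
  · exact coneHt_cornerArc P.gr.hℓ (P.apex_spec.2.1 q hq) h₁ h₂ i ht
  · exact coneHt_cornerArc_floor P.gr.hℓ (P.apex_spec.2.2 q hq) h₁ h₂ i ht

omit [NormedSpace ℝ B] in
/-- **The tame dichotomy for the corner arcs**: on an initial parameter interval, either the
whole arc lies in the square or none of its points with positive parameter does. [folklore] -/
theorem exists_arc_dichotomy (i : Bool) : ∃ δ > (0 : ℝ), δ ≤ 2 * P.gr.ℓ ∧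
    ((∀ t ∈ Ioc 0 δ, P.arc q (s₁ := s₁) (s₂ := s₂) i t ∈ P.gr.sq q) ∨
      ∀ t ∈ Ioc 0 δ, P.arc q (s₁ := s₁) (s₂ := s₂) i t ∉ P.gr.sq q) := by
  have hℓ := P.gr.hℓ
  obtain ⟨δ, hδ, hδℓ, htame⟩ := P.exists_tame_cornerEdge q h₁ h₂ i
  refine ⟨δ, hδ, hδℓ, ?_⟩
  have hsph : ∀ {t}, t ∈ Ioc 0 δ → corner (P.gr.centre q) P.gr.ℓ s₁ s₂ + t • cornerDir s₁ s₂ i ∈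
      sphere (P.gr.centre q) P.gr.ℓ := fun {t} ht ↦
    corner_add_smul_mem_sphere hℓ h₁ h₂ i ⟨ht.1.le, ht.2.trans hδℓ⟩
  have hv := corner_mem_sphere (c := P.gr.centre q) hℓ h₁ h₂
  by_cases hq : P.roofPat q
  · have hroof := P.apex_spec.2.1 q hq
    rcases forall_le_or_forall_lt_of_tame htame with h | h
    · refine Or.inl fun t ht ↦ ?_
      rw [arc_def, cornerArc]
      exact (levelPt_mem_closedBall_iff hℓ (hsph ht) (hroof _ (hsph ht)) (hroof _ hv).le).2 (by simpa using h t ht)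
    · refine Or.inr fun t ht hmem ↦ ?_
      rw [arc_def, cornerArc] at hmem
      have := (levelPt_mem_closedBall_iff hℓ (hsph ht) (hroof _ (hsph ht)) (hroof _ hv).le).1 hmem
      have h' := h t ht
      simp only [zero_smul, add_zero] at h'
      linarith
  · have hfloor := P.apex_spec.2.2 q hq
    rcases forall_ge_or_forall_gt_of_tame htame with h | h
    · refine Or.inl fun t ht ↦ ?_
      rw [arc_def, cornerArc]
      exact (levelPt_mem_closedBall_iff_floor hℓ (hsph ht) (hfloor _ (hsph ht)) (hfloor _ hv).le).2 (by simpa using h t ht)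
    · refine Or.inr fun t ht hmem ↦ ?_
      rw [arc_def, cornerArc] at hmem
      have := (levelPt_mem_closedBall_iff_floor hℓ (hsph ht) (hfloor _ (hsph ht)) (hfloor _ hv).le).1 hmem
      have h' := h t ht
      simp only [zero_smul, add_zero] at h'
      linarith

/-- **Level points of the square near its corner lie on the corner arcs** (roof and floor).
[folklore] -/
theorem exists_eq_arc {x : ℝ × ℝ} (hx : x ∈ P.gr.sq q) {r : ℝ} (hr : r ≤ P.gr.ℓ / 8)
    (hxv : dist x (corner (P.gr.centre q) P.gr.ℓ s₁ s₂) < r)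
    (hlev : height (P.box q) (P.fill P.apex x) = P.bdryHt q (corner (P.gr.centre q) P.gr.ℓ s₁ s₂)) :
    x = corner (P.gr.centre q) P.gr.ℓ s₁ s₂ ∨
      ∃ (i : Bool) (t : ℝ), t ∈ Ioo 0 (4 * r) ∧ P.arc q (s₁ := s₁) (s₂ := s₂) i t ∈ P.gr.sq q ∧
        x = P.arc q (s₁ := s₁) (s₂ := s₂) i t := by
  rw [P.height_fill_eq_coneHt hx] at hlev
  by_cases hq : P.roofPat q
  · rcases eq_corner_or_exists_eq_cornerArc P.gr.hℓ (P.apex_spec.2.1 q hq) h₁ h₂ hx hr hxv hlev with h | ⟨i, t, ht, -, hxt⟩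
    · exact Or.inl h
    · exact Or.inr ⟨i, t, ht, by rw [arc_def, ← hxt]; exact hx, hxt⟩
  · rcases eq_corner_or_exists_eq_cornerArc_floor P.gr.hℓ (P.apex_spec.2.2 q hq) h₁ h₂ hx hr hxv hlev with
      h | ⟨i, t, ht, -, hxt⟩
    · exact Or.inl h
    · exact Or.inr ⟨i, t, ht, by rw [arc_def, ← hxt]; exact hx, hxt⟩

/-- **The corner arc inside the square is leafwise**: two of its points, at parameters in an
interval on which the arc lies in the square and in the carrier, lie on the same leaf of the
contour foliation. [folklore] -/
theorem arc_mem_leaf (i : Bool) {a b : ℝ} (hab : a ≤ b) (ha : 0 ≤ a) (hb : b ≤ 2 * P.gr.ℓ)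
    (hsq : ∀ t ∈ Icc a b, P.arc q (s₁ := s₁) (s₂ := s₂) i t ∈ P.gr.sq q)
    (hX : ∀ t ∈ Icc a b, P.arc q (s₁ := s₁) (s₂ := s₂) i t ∈ P.gr.X₀) :
    (⟨P.arc q (s₁ := s₁) (s₂ := s₂) i a, hX a ⟨le_rfl, hab⟩⟩ : P.gr.X₀) ∈
      (P.contourFol ho).leaf ⟨P.arc q (s₁ := s₁) (s₂ := s₂) i b, hX b ⟨hab, le_rfl⟩⟩ := by
  haveI : PreconnectedSpace (Icc a b) := Subtype.preconnectedSpace isPreconnected_Icc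
  -- the arc as a map into the carrier
  set α : Icc a b → P.gr.X₀ := fun u ↦ ⟨P.arc q (s₁ := s₁) (s₂ := s₂) i u, hX u u.2⟩ with hα
  have hIcc : Icc a b ⊆ Icc 0 (2 * P.gr.ℓ) := Icc_subset_Icc ha hb
  have hαc : Continuous α := by
    refine Continuous.subtype_mk ?_ _
    exact ((P.continuousOn_arc q h₁ h₂ i).mono hIcc).comp_continuous continuous_subtype_val fun u ↦ u.2
  -- `fill ∘ α` is leafwise in `F`: constant height in the box of `q`
  have hfill : Continuous (toLeafSpace ∘ ((fun y : P.gr.X₀ ↦ P.fill P.apex (y : ℝ × ℝ)) ∘ α) : Icc a b → F.LeafSpace) := by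
    refine continuous_iff_continuousAt.2 fun u ↦ F.continuousAt_toLeafSpace_comp ?_ (P.box_mem q)
      (P.fill_mem_source P.apex_spec.1 (hsq u u.2)) (Eventually.of_forall fun u' ↦ ?_)
    · exact (P.continuous_fill_coe.comp hαc).continuousAt
    · show height (P.box q) (P.fill P.apex (P.arc q i u')) = height (P.box q) (P.fill P.apex (P.arc q i u))
      rw [P.height_fill_arc q h₁ h₂ i (hIcc u'.2) (hsq u' u'.2), P.height_fill_arc q h₁ h₂ i (hIcc u.2) (hsq u u.2)]
  -- hence `α` is leafwise in the contour foliation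
  have hleaf := (P.isFoliatedMap_fill ho).continuous_toLeafSpace_of_comp hαc hfill
  exact (P.contourFol ho).mem_leaf_of_continuous_toLeafSpace hleaf ⟨b, hab, le_rfl⟩ ⟨a, le_rfl, hab⟩

/-- **Finitely many leaves cover the level set of the corner height near the corner, within the
square**: for a corner `v` of the square `q` which is a puncture in the open big square, there
are `r > 0` and a finite set `S` of points of the carrier such that every point of the carrier in
the square, within `r` of `v`, at which the box height of the filled map is the corner height,
lies on the leaf of a point of `S`. [folklore] -/
theorem exists_cover_corner (hvP : corner (P.gr.centre q) P.gr.ℓ s₁ s₂ ∈ P.gr.centres ∪ P.gr.vertices)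
    (hvb : corner (P.gr.centre q) P.gr.ℓ s₁ s₂ ∈ ball P.gr.bigCentre (P.gr.n * P.gr.ℓ)) :
    ∃ r > (0 : ℝ), ∃ S : Set P.gr.X₀, S.Finite ∧ ∀ y : P.gr.X₀, (y : ℝ × ℝ) ∈ P.gr.sq q →
      dist (y : ℝ × ℝ) (corner (P.gr.centre q) P.gr.ℓ s₁ s₂) < r →
      height (P.box q) (P.fill P.apex y) = P.bdryHt q (corner (P.gr.centre q) P.gr.ℓ s₁ s₂) →
      ∃ s ∈ S, y ∈ (P.contourFol ho).leaf s := by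
  have hℓ := P.gr.hℓ
  set v := corner (P.gr.centre q) P.gr.ℓ s₁ s₂ with hv
  -- tame dichotomies
  choose δ hδpos hδℓ hdich using fun i ↦ P.exists_arc_dichotomy q h₁ h₂ i
  -- the radius `ε`: half a mesh, and inside the open big square
  set ε := min (P.gr.ℓ / 2) (P.gr.n * P.gr.ℓ - dist v P.gr.bigCentre) with hε
  have hvb' : dist v P.gr.bigCentre < P.gr.n * P.gr.ℓ := mem_ball.1 hvb
  have hεpos : 0 < ε := lt_min (by linarith) (by linarith)
  -- continuity of the arcs at the corner
  have hη : ∀ i : Bool, ∃ η > (0 : ℝ), ∀ t ∈ Icc 0 (2 * P.gr.ℓ), t < η →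
      dist (P.arc q (s₁ := s₁) (s₂ := s₂) i t) v < ε := by
    intro i
    have hc := (P.continuousOn_arc q h₁ h₂ i) 0 ⟨le_rfl, by linarith⟩
    rw [Metric.continuousWithinAt_iff] at hc
    obtain ⟨η, hη, h⟩ := hc ε hεpos
    refine ⟨η, hη, fun t ht htη ↦ ?_⟩
    have h' := h ht (by rw [Real.dist_eq, sub_zero, abs_of_nonneg ht.1]; exact htη)
    rwa [P.arc_zero q h₁ h₂ i] at h'
  choose η hηpos hη using hη
  -- the radius `r`
  set K := min (min (δ true) (δ false)) (min (η true) (η false)) with hK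
  have hKpos : 0 < K := lt_min (lt_min (hδpos _) (hδpos _)) (lt_min (hηpos _) (hηpos _))
  have hKδ : ∀ i, K ≤ δ i := fun i ↦ by cases i <;> simp [hK]
  have hKη : ∀ i, K ≤ η i := fun i ↦ by cases i <;> simp [hK]
  set r := min (P.gr.ℓ / 8) (K / 8) with hr
  have hrpos : 0 < r := lt_min (by linarith) (by linarith)
  have hrℓ : r ≤ P.gr.ℓ / 8 := min_le_left _ _
  have hrK : 4 * r < K := by have := min_le_right (P.gr.ℓ / 8) (K / 8); linarith
  set t₀ := 4 * r with ht₀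
  have ht₀ℓ : t₀ ≤ 2 * P.gr.ℓ := by linarith
  -- arc points with parameter in `(0, t₀]` are in the carrier
  have harcX : ∀ (i : Bool) (t : ℝ), t ∈ Ioc 0 t₀ → P.arc q (s₁ := s₁) (s₂ := s₂) i t ∈ P.gr.X₀ := by
    intro i t ht
    have htI : t ∈ Icc 0 (2 * P.gr.ℓ) := ⟨ht.1.le, ht.2.trans ht₀ℓ⟩
    have hdv : dist (P.arc q (s₁ := s₁) (s₂ := s₂) i t) v < ε := hη i t htI (by linarith [ht.2, hKη i])
    have hne : P.arc q (s₁ := s₁) (s₂ := s₂) i t ≠ v := P.arc_ne_corner q h₁ h₂ i ⟨ht.1, htI.2⟩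
    have hnotP : P.arc q (s₁ := s₁) (s₂ := s₂) i t ∉ P.gr.centres ∪ P.gr.vertices := fun h ↦ by
      have := P.gr.le_dist_of_mem_punct h hvP hne
      linarith [min_le_left (P.gr.ℓ / 2) (P.gr.n * P.gr.ℓ - dist v P.gr.bigCentre)]
    rw [P.gr.mem_X₀_iff]
    refine ⟨?_, fun h ↦ hnotP (Or.inl h), fun h ↦ hnotP (Or.inr h)⟩
    rw [mem_ball]
    calc dist (P.arc q i t) P.gr.bigCentre ≤ dist (P.arc q i t) v + dist v P.gr.bigCentre := dist_triangle _ _ _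
      _ < ε + dist v P.gr.bigCentre := by linarith
      _ ≤ P.gr.n * P.gr.ℓ := by linarith [min_le_right (P.gr.ℓ / 2) (P.gr.n * P.gr.ℓ - dist v P.gr.bigCentre)]
  -- the finite set: the arc points at parameter `t₀` (those in the carrier)
  set S : Set P.gr.X₀ := (fun y : P.gr.X₀ ↦ (y : ℝ × ℝ)) ⁻¹' range fun i : Bool ↦ P.arc q (s₁ := s₁) (s₂ := s₂) i t₀
    with hS
  refine ⟨r, hrpos, S, (finite_range _).preimage Subtype.val_injective.injOn, fun y hysq hdist hlev ↦ ?_⟩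
  rcases P.exists_eq_arc q h₁ h₂ hysq hrℓ hdist hlev with hyv | ⟨i, t, ht, hsqt, hyt⟩
  · -- `y` would be the puncture `v`
    exfalso
    have hy := (P.gr.mem_X₀_iff).1 y.2
    rw [hyv] at hy
    rcases hvP with h | h
    · exact hy.2.1 h
    · exact hy.2.2 h
  · -- the arc `i` is admissible
    have ht₀δ : t₀ ≤ δ i := by linarith [hKδ i]
    rcases hdich i with hadm | hnot
    swap
    · exact absurd hsqt (hnot t ⟨ht.1, ht.2.le.trans ht₀δ⟩)
    -- the base point of `S` on this arc
    have hmem₀ : P.arc q (s₁ := s₁) (s₂ := s₂) i t₀ ∈ P.gr.X₀ := harcX i t₀ ⟨by linarith, le_rfl⟩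
    refine ⟨⟨P.arc q (s₁ := s₁) (s₂ := s₂) i t₀, hmem₀⟩, ⟨i, rfl⟩, ?_⟩
    have key := P.arc_mem_leaf ho q h₁ h₂ i ht.2.le ht.1.le ht₀ℓ
      (fun t' ht' ↦ hadm t' ⟨ht.1.trans_le ht'.1, ht'.2.trans ht₀δ⟩)
      (fun t' ht' ↦ harcX i t' ⟨ht.1.trans_le ht'.1, ht'.2⟩)
    have hyeq : y = ⟨P.arc q (s₁ := s₁) (s₂ := s₂) i t, harcX i t ⟨ht.1, ht.2.le⟩⟩ := Subtype.ext hyt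
    rw [hyeq]
    exact key

end Corner

/-! ## The local data at a centre and at a vertex -/

section LocalData

variable (ho : F.IsTransverselyOriented)

/-- The filled map is continuous at the points of the open big square. [folklore] -/
theorem continuousAt_fill {x : ℝ × ℝ} (hx : x ∈ ball P.gr.bigCentre (P.gr.n * P.gr.ℓ)) :
    ContinuousAt (P.fill P.apex) x := by
  have hS : P.gr.S ∈ 𝓝 x := mem_of_superset (isOpen_ball.mem_nhds hx) ball_subset_closedBall
  have h := P.continuousOn_fill (m := P.apex)
  rw [← grid_S hL P.hn] at h
  exact h.continuousAt hS

omit [NormedSpace ℝ B] in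
/-- Points within `ℓ` of the centre of a square are in the square. [folklore] -/
theorem mem_sq_of_dist_lt {q : Fin P.n × Fin P.n} {y : ℝ × ℝ} (hy : dist y (P.gr.centre q) < P.gr.ℓ) : y ∈ P.gr.sq q :=
  mem_closedBall.2 hy.le

/-- **At a centre, no nearby point of the carrier has the apex height.** [folklore] -/
theorem height_ne_of_mem_centres (q : Fin P.n × Fin P.n) (y : P.gr.X₀) (hy : dist (y : ℝ × ℝ) (P.gr.centre q) < P.gr.ℓ) :
    height (P.box q) (P.fill P.apex y) ≠ height (P.box q) (P.fill P.apex (P.gr.centre q)) := by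
  have hℓ := P.gr.hℓ
  have hysq : (y : ℝ × ℝ) ∈ P.gr.sq q := P.mem_sq_of_dist_lt hy
  have hyc : (y : ℝ × ℝ) ≠ P.gr.centre q := fun h ↦ ((P.gr.mem_X₀_iff).1 y.2).2.1 ⟨q, h.symm⟩
  rw [P.height_fill_eq_coneHt hysq, P.height_fill_eq_coneHt (P.gr.centre_mem_sq q), coneHt_center]
  by_cases hq : P.roofPat q
  · exact (coneHt_lt_apex hℓ (P.apex_spec.2.1 q hq) hyc).ne
  · exact (apex_lt_coneHt hℓ (P.apex_spec.2.2 q hq) hyc).ne'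

/-- Signs are preserved by negation. [folklore] -/
theorem _root_.Literature.Topology.FourManifolds.ConeSquare.IsSign.neg {σ : ℝ} (h : IsSign σ) : IsSign (-σ) := by
  rcases h with rfl | rfl
  · exact Or.inr rfl
  · exact Or.inl (by norm_num)

/-- **At an interior vertex, finitely many leaves cover the nearby points of the carrier at the
level of the vertex** (read in the box of the upper-right square at the vertex). [folklore] -/
theorem exists_cover_vertex {v : ℝ × ℝ} (hv : v ∈ P.gr.vertices) (hvb : v ∈ ball P.gr.bigCentre (P.gr.n * P.gr.ℓ))
    {q₀ : Fin P.n × Fin P.n} (hq₀ : P.gr.centre q₀ = (v.1 + 1 * P.gr.ℓ, v.2 + 1 * P.gr.ℓ)) :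
    ∃ r > (0 : ℝ), r ≤ P.gr.ℓ ∧ ∃ S : Set P.gr.X₀, S.Finite ∧ ∀ y : P.gr.X₀, dist (y : ℝ × ℝ) v < r →
      height (P.box q₀) (P.fill P.apex y) = height (P.box q₀) (P.fill P.apex v) →
      ∃ s ∈ S, y ∈ (P.contourFol ho).leaf s := by
  have hℓ := P.gr.hℓ
  have hone : IsSign (1 : ℝ) := Or.inl rfl
  have hvq₀ : v ∈ P.gr.sq q₀ := P.gr.mem_sq_of_centre_eq hone hone hq₀
  have hvP : v ∈ P.gr.centres ∪ P.gr.vertices := Or.inr hv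
  -- the four squares at `v`, indexed by pairs of signs
  have hsq : ∀ σ : Bool × Bool, ∃ q : Fin P.n × Fin P.n,
      P.gr.centre q = (v.1 + (if σ.1 then 1 else -1) * P.gr.ℓ, v.2 + (if σ.2 then 1 else -1) * P.gr.ℓ) := fun σ ↦
    P.gr.exists_sq_of_mem_vertices hv hvb (by cases σ.1 <;> simp [IsSign]) (by cases σ.2 <;> simp [IsSign])
  choose sq hsqc using hsq
  have hsgn : ∀ σ : Bool × Bool, IsSign (if σ.1 then (1 : ℝ) else -1) ∧ IsSign (if σ.2 then (1 : ℝ) else -1) := fun σ ↦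
    ⟨by cases σ.1 <;> simp [IsSign], by cases σ.2 <;> simp [IsSign]⟩
  have hvsq : ∀ σ, v ∈ P.gr.sq (sq σ) := fun σ ↦ P.gr.mem_sq_of_centre_eq (hsgn σ).1 (hsgn σ).2 (hsqc σ)
  have hcorner : ∀ σ, v = corner (P.gr.centre (sq σ)) P.gr.ℓ (-(if σ.1 then (1 : ℝ) else -1)) (-(if σ.2 then (1 : ℝ) else -1)) :=
    fun σ ↦ P.gr.eq_corner_of_centre_eq (hsqc σ)
  -- per square: the finite cover of the corner level set
  have hcov : ∀ σ : Bool × Bool, ∃ r > (0 : ℝ), ∃ S : Set P.gr.X₀, S.Finite ∧ ∀ y : P.gr.X₀, (y : ℝ × ℝ) ∈ P.gr.sq (sq σ) →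
      dist (y : ℝ × ℝ) v < r → height (P.box (sq σ)) (P.fill P.apex y) = P.bdryHt (sq σ) v →
      ∃ s ∈ S, y ∈ (P.contourFol ho).leaf s := by
    intro σ
    have h := P.exists_cover_corner ho (sq σ) (hsgn σ).1.neg (hsgn σ).2.neg (by rw [← hcorner σ]; exact hvP)
      (by rw [← hcorner σ]; exact hvb)
    rw [← hcorner σ] at h
    exact h
  choose r hrpos S hSfin hS using hcov
  -- per square: the transition from its box to the box of `q₀`, near `fill v`
  have hfv : ∀ σ, P.fill P.apex v ∈ (P.box (sq σ)).source := fun σ ↦ P.fill_mem_source P.apex_spec.1 (hvsq σ)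
  have hfv₀ : P.fill P.apex v ∈ (P.box q₀).source := P.fill_mem_source P.apex_spec.1 hvq₀
  have htrans : ∀ σ : Bool × Bool, ∃ ρ > (0 : ℝ), ∀ y : ℝ × ℝ, dist y v < ρ →
      height (P.box q₀) (P.fill P.apex y) = height (P.box q₀) (P.fill P.apex v) →
      height (P.box (sq σ)) (P.fill P.apex y) = height (P.box (sq σ)) (P.fill P.apex v) := by
    intro σ
    have hU := F.eventually_height_eq_transition (P.box_mem (sq σ)) (P.box_mem q₀) (hfv σ) hfv₀
    obtain ⟨W, hW, hinj⟩ := (F.isHomeoGermAt_transition (P.box_mem (sq σ)) (P.box_mem q₀) (hfv σ) hfv₀).eventually_injective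
    have hcf : ContinuousAt (P.fill P.apex) v := P.continuousAt_fill hvb
    have hch : ContinuousAt (fun y ↦ height (P.box (sq σ)) (P.fill P.apex y)) v :=
      (continuous_snd.continuousAt.comp ((P.box (sq σ)).continuousAt (hfv σ))).comp hcf
    have hev : ∀ᶠ y in 𝓝 v, height (P.box q₀) (P.fill P.apex y) =
        transition (P.box (sq σ)) (P.box q₀) (P.fill P.apex v) (height (P.box (sq σ)) (P.fill P.apex y)) ∧
        height (P.box (sq σ)) (P.fill P.apex y) ∈ W := by
      filter_upwards [hcf.eventually hU, hch.preimage_mem_nhds hW] with y hy hyW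
      exact ⟨hy, hyW⟩
    obtain ⟨ρ, hρ, hball⟩ := Metric.eventually_nhds_iff.1 hev
    refine ⟨ρ, hρ, fun y hy hlev ↦ ?_⟩
    obtain ⟨hy₁, hy₂⟩ := hball hy
    obtain ⟨hv₁, hv₂⟩ := hball (y := v) (by rw [dist_self]; exact hρ)
    apply hinj hy₂ hv₂
    rw [← hy₁, ← hv₁]
    exact hlev
  choose ρ hρpos hρ using htrans
  -- the radius: all per-square radii, and `ℓ`
  have hfinB : (univ : Set (Bool × Bool)).Finite := finite_univ
  obtain ⟨R, hRpos, hR⟩ : ∃ R > (0 : ℝ), R ≤ P.gr.ℓ ∧ ∀ σ, R ≤ r σ ∧ R ≤ ρ σ := by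
    refine ⟨min P.gr.ℓ (min (min (min (r (true, true)) (r (true, false))) (min (r (false, true)) (r (false, false))))
      (min (min (ρ (true, true)) (ρ (true, false))) (min (ρ (false, true)) (ρ (false, false))))), ?_, min_le_left _ _, ?_⟩
    · refine lt_min hℓ (lt_min ?_ ?_)
      · exact lt_min (lt_min (hrpos _) (hrpos _)) (lt_min (hrpos _) (hrpos _))
      · exact lt_min (lt_min (hρpos _) (hρpos _)) (lt_min (hρpos _) (hρpos _))
    · rintro ⟨a, b⟩
      cases a <;> cases b <;>
        exact ⟨le_trans (min_le_right _ _) (by simp), le_trans (min_le_right _ _) (by simp)⟩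
  refine ⟨R, hRpos, hR.1, ⋃ σ, S σ, finite_iUnion fun σ ↦ hSfin σ, fun y hy hlev ↦ ?_⟩
  -- the square of the quadrant of `y`
  set σ : Bool × Bool := (decide (0 ≤ (y : ℝ × ℝ).1 - v.1), decide (0 ≤ (y : ℝ × ℝ).2 - v.2)) with hσ
  have hyd := hy
  rw [Prod.dist_eq, Real.dist_eq, Real.dist_eq, max_lt_iff] at hyd
  have hysq : (y : ℝ × ℝ) ∈ P.gr.sq (sq σ) := by
    refine P.gr.mem_sq_of_quadrant (hsgn σ).1 (hsgn σ).2 (hsqc σ) ?_ ?_ ?_ ?_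
    · by_cases h : 0 ≤ (y : ℝ × ℝ).1 - v.1
      · simp [hσ, h]
      · simp [hσ, h]; linarith
    · exact le_of_lt (hyd.1.trans_le (hR.1.trans (by linarith)))
    · by_cases h : 0 ≤ (y : ℝ × ℝ).2 - v.2
      · simp [hσ, h]
      · simp [hσ, h]; linarith
    · exact le_of_lt (hyd.2.trans_le (hR.1.trans (by linarith)))
  -- in the box of that square, `y` is at the corner height
  have hlevσ := hρ σ y (hy.trans_le (hR.2 σ).2) hlev
  have hvbd : height (P.box (sq σ)) (P.fill P.apex v) = P.bdryHt (sq σ) v := by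
    have hvs : v ∈ sphere (P.gr.centre (sq σ)) P.gr.ℓ := by
      rw [hcorner σ]; exact corner_mem_sphere hℓ (hsgn σ).1.neg (hsgn σ).2.neg
    rw [P.height_fill_eq_coneHt (hvsq σ), coneHt_of_mem_sphere hℓ hvs]
  rw [hvbd] at hlevσ
  obtain ⟨s, hs, hys⟩ := hS σ y hysq (hy.trans_le (hR.2 σ).1) hlevσ
  exact ⟨s, mem_iUnion.2 ⟨σ, hs⟩, hys⟩

omit [NormedSpace ℝ B] in
/-- Points within `ℓ` of an interior vertex lie in a square containing the vertex. [folklore] -/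
theorem exists_sq_of_dist_lt_vertex {v : ℝ × ℝ} (hv : v ∈ P.gr.vertices) (hvb : v ∈ ball P.gr.bigCentre (P.gr.n * P.gr.ℓ))
    {y : ℝ × ℝ} (hy : dist y v < P.gr.ℓ) : ∃ q : Fin P.n × Fin P.n, y ∈ P.gr.sq q ∧ v ∈ P.gr.sq q := by
  have hℓ := P.gr.hℓ
  set a : Bool := decide (0 ≤ y.1 - v.1)
  set b : Bool := decide (0 ≤ y.2 - v.2)
  have hsa : IsSign (if a then (1 : ℝ) else -1) := by cases a <;> simp [IsSign]
  have hsb : IsSign (if b then (1 : ℝ) else -1) := by cases b <;> simp [IsSign]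
  obtain ⟨q, hq⟩ := P.gr.exists_sq_of_mem_vertices hv hvb hsa hsb
  rw [Prod.dist_eq, Real.dist_eq, Real.dist_eq, max_lt_iff] at hy
  refine ⟨q, P.gr.mem_sq_of_quadrant hsa hsb hq ?_ (by linarith [le_of_lt hy.1]) ?_ (by linarith [le_of_lt hy.2]),
    P.gr.mem_sq_of_centre_eq hsa hsb hq⟩
  · by_cases h : 0 ≤ y.1 - v.1
    · simp [a, h]
    · simp [a, h]; linarith
  · by_cases h : 0 ≤ y.2 - v.2
    · simp [b, h]
    · simp [b, h]; linarith

end LocalData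

/-! ## The puncture data -/

section Data

variable (ho : F.IsTransverselyOriented)

/-- The real coordinates of a complex number. [folklore] -/
def toR (z : ℂ) : ℝ × ℝ := (z.re, z.im)

omit [NormedSpace ℝ B] in
/-- `toR` inverts the plane embedding. [folklore] -/
@[simp] theorem toR_planeEmb (y : P.gr.X₀) : toR (P.gr.planeEmb y) = (y : ℝ × ℝ) := by
  simp [toR, SquareGrid.Grid.planeEmb]

omit [NormedSpace ℝ B] in
/-- The plane embedding of the point with given real coordinates. [folklore] -/
theorem planeEmb_mk {z : ℂ} (hz : toR z ∈ P.gr.X₀) : P.gr.planeEmb ⟨toR z, hz⟩ = z := by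
  apply Complex.ext <;> simp [toR, SquareGrid.Grid.planeEmb]

/-- `toR` is injective. [folklore] -/
theorem toR_injective : Injective toR := fun z w h ↦ by
  simp only [toR, Prod.mk.injEq] at h
  exact Complex.ext h.1 h.2

/-- `toR` is continuous. [folklore] -/
theorem continuous_toR : Continuous toR := Complex.continuous_re.prodMk Complex.continuous_im

/-- `toR` does not increase distances (max norm on `ℝ × ℝ`). [folklore] -/
theorem dist_toR_le (z w : ℂ) : dist (toR z) (toR w) ≤ dist z w := by
  rw [Prod.dist_eq, toR, toR, Real.dist_eq, Real.dist_eq, dist_eq_norm]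
  refine max_le ?_ ?_
  · rw [← Complex.sub_re]; exact Complex.abs_re_le_norm _
  · rw [← Complex.sub_im]; exact Complex.abs_im_le_norm _

/-- **The filled map, read on the complex plane.** [folklore] -/
def fillC (z : ℂ) : M := P.fill P.apex (toR z)

/-- The region: the open big square. [folklore] -/
def Ω : Set ℂ := toR ⁻¹' ball P.gr.bigCentre (P.gr.n * P.gr.ℓ)

/-- The punctures: centres and vertices in the open big square. [folklore] -/
def punct : Set ℂ := toR ⁻¹' (P.gr.centres ∪ P.gr.vertices) ∩ P.Ω

omit [NormedSpace ℝ B] in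
/-- Membership in the region. [folklore] -/
theorem mem_Ω_iff {z : ℂ} : z ∈ P.Ω ↔ toR z ∈ ball P.gr.bigCentre (P.gr.n * P.gr.ℓ) := Iff.rfl

omit [NormedSpace ℝ B] in
/-- Membership in the punctures. [folklore] -/
theorem mem_punct_iff {z : ℂ} : z ∈ P.punct ↔ toR z ∈ P.gr.centres ∪ P.gr.vertices ∧ toR z ∈ ball P.gr.bigCentre (P.gr.n * P.gr.ℓ) :=
  Iff.rfl

/-- **The local data at a puncture**: a flow box of `F` at the image, a radius, and the finite
cover of the level set. [folklore] -/
theorem exists_localData (v : ℂ) (hv : v ∈ P.punct) : ∃ (e : OpenPartialHomeomorph M (B × ℝ)) (r : ℝ) (S : Set P.gr.X₀),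
    e ∈ F.atlas ∧ 0 < r ∧ ball v r ⊆ P.Ω ∧ (∀ v' ∈ P.punct, v' ∈ ball v r → v' = v) ∧
    MapsTo P.fillC (ball v r) e.source ∧ S.Finite ∧
    ∀ y : P.gr.X₀, P.gr.planeEmb y ∈ ball v r → (e (P.fillC (P.gr.planeEmb y))).2 = (e (P.fillC v)).2 →
      ∃ s ∈ S, y ∈ (P.contourFol ho).leaf s := by
  have hℓ := P.gr.hℓ
  obtain ⟨hvP, hvb⟩ := (P.mem_punct_iff).1 hv
  set gap := P.gr.n * P.gr.ℓ - dist (toR v) P.gr.bigCentre with hgap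
  have hgappos : 0 < gap := by have := mem_ball.1 hvb; linarith
  -- common facts for a radius `r ≤ min (ℓ / 2) gap`
  have hcommon : ∀ {r : ℝ}, r ≤ min (P.gr.ℓ / 2) gap →
      ball v r ⊆ P.Ω ∧ (∀ v' ∈ P.punct, v' ∈ ball v r → v' = v) := by
    intro r hr
    have hr₁ : r ≤ P.gr.ℓ / 2 := hr.trans (min_le_left _ _)
    have hr₂ : r ≤ gap := hr.trans (min_le_right _ _)
    constructor
    · intro z hz
      rw [mem_Ω_iff, mem_ball]
      have h := (dist_toR_le z v).trans_lt (mem_ball.1 hz)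
      calc dist (toR z) P.gr.bigCentre ≤ dist (toR z) (toR v) + dist (toR v) P.gr.bigCentre := dist_triangle _ _ _
        _ < P.gr.n * P.gr.ℓ := by linarith
    · intro v' hv' hv'b
      by_contra hne
      have hne' : toR v' ≠ toR v := fun h ↦ hne (toR_injective h)
      have h := P.gr.le_dist_of_mem_punct ((P.mem_punct_iff).1 hv').1 hvP hne'
      have h' := (dist_toR_le v' v).trans_lt (mem_ball.1 hv'b)
      linarith
  rcases hvP with ⟨q, hq⟩ | hvV
  · -- a centre
    set r := min (P.gr.ℓ / 2) gap with hr
    have hrpos : 0 < r := lt_min (by linarith) hgappos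
    obtain ⟨hball, huniq⟩ := hcommon (r := r) le_rfl
    refine ⟨P.box q, r, ∅, P.box_mem q, hrpos, hball, huniq, fun z hz ↦ ?_, finite_empty, fun y hy hlev ↦ ?_⟩
    · -- `toR z` is in the square
      have hd : dist (toR z) (P.gr.centre q) < P.gr.ℓ := by
        rw [hq]; have := (dist_toR_le z v).trans_lt (mem_ball.1 hz); linarith [min_le_left (P.gr.ℓ / 2) gap]
      exact P.fill_mem_source P.apex_spec.1 (P.mem_sq_of_dist_lt hd)
    · exfalso
      have hd : dist (y : ℝ × ℝ) (P.gr.centre q) < P.gr.ℓ := by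
        rw [hq, ← P.toR_planeEmb y]
        have := (dist_toR_le _ v).trans_lt (mem_ball.1 hy); linarith [min_le_left (P.gr.ℓ / 2) gap]
      refine P.height_ne_of_mem_centres q y hd ?_
      have h : toR v = P.gr.centre q := hq.symm
      simpa [fillC, toR_planeEmb, h, height] using hlev
  · -- a vertex
    have hone : IsSign (1 : ℝ) := Or.inl rfl
    obtain ⟨q₀, hq₀⟩ := P.gr.exists_sq_of_mem_vertices hvV hvb hone hone
    have hvq₀ : toR v ∈ P.gr.sq q₀ := P.gr.mem_sq_of_centre_eq hone hone hq₀
    obtain ⟨r₁, hr₁pos, hr₁ℓ, S, hSfin, hS⟩ := P.exists_cover_vertex ho hvV hvb hq₀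
    set r := min r₁ (min (P.gr.ℓ / 2) gap) with hr
    have hrpos : 0 < r := lt_min hr₁pos (lt_min (by linarith) hgappos)
    obtain ⟨hball, huniq⟩ := hcommon (r := r) (min_le_right _ _)
    refine ⟨P.box q₀, r, S, P.box_mem q₀, hrpos, hball, huniq, fun z hz ↦ ?_, hSfin, fun y hy hlev ↦ ?_⟩
    · have hd : dist (toR z) (toR v) < P.gr.ℓ := by
        have := (dist_toR_le z v).trans_lt (mem_ball.1 hz)
        linarith [min_le_right r₁ (min (P.gr.ℓ / 2) gap), min_le_left (P.gr.ℓ / 2) gap]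
      obtain ⟨q', hzq', hvq'⟩ := P.exists_sq_of_dist_lt_vertex hvV hvb hd
      exact P.fill_mem_source_of_adj P.apex_spec.1 (P.gr.adj_of_inter_nonempty ⟨toR v, hvq', hvq₀⟩) hzq'
    · have hd : dist (y : ℝ × ℝ) (toR v) < r₁ := by
        rw [← P.toR_planeEmb y]
        exact ((dist_toR_le _ v).trans_lt (mem_ball.1 hy)).trans_le (min_le_left _ _)
      refine hS y hd ?_
      simpa [fillC, toR_planeEmb, height] using hlev

/-- **The puncture data of a disc in checkerboard cone position.** [folklore] -/
def punctureData : PunctureData (P.contourFol ho) P.gr.planeEmb F P.fillC := by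
  classical
  haveI : Nonempty (OpenPartialHomeomorph M (B × ℝ)) := ⟨P.box (⟨0, P.hn⟩, ⟨0, P.hn⟩)⟩
  choose! e r S he hr hball huniq hmaps hSfin hS using P.exists_localData ho
  exact
    { Ω := P.Ω
      isOpen_Ω := isOpen_ball.preimage continuous_toR
      P := P.punct
      P_finite := ((P.gr.finite_centres.union P.gr.finite_vertices).preimage toR_injective.injOn).subset
        inter_subset_left
      P_subset := inter_subset_right
      range_eq := by
        ext z
        constructor
        · rintro ⟨y, rfl⟩
          have hy := (P.gr.mem_X₀_iff).1 y.2
          refine ⟨?_, fun h ↦ ?_⟩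
          · rw [mem_Ω_iff, toR_planeEmb]; exact hy.1
          · have h' := ((P.mem_punct_iff).1 h).1
            rw [toR_planeEmb] at h'
            rcases h' with h' | h'
            · exact hy.2.1 h'
            · exact hy.2.2 h'
        · rintro ⟨hzΩ, hzP⟩
          have hz : toR z ∈ P.gr.X₀ := by
            rw [P.gr.mem_X₀_iff]
            refine ⟨hzΩ, fun h ↦ hzP ⟨Or.inl h, hzΩ⟩, fun h ↦ hzP ⟨Or.inr h, hzΩ⟩⟩
          exact ⟨⟨toR z, hz⟩, P.planeEmb_mk hz⟩
      continuousOn := by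
        have h := P.continuousOn_fill (m := P.apex)
        rw [← grid_S hL P.hn] at h
        exact h.comp continuous_toR.continuousOn fun z hz ↦ ball_subset_closedBall hz
      foliated := by
        have h : P.fillC ∘ P.gr.planeEmb = fun y : P.gr.X₀ ↦ P.fill P.apex (y : ℝ × ℝ) := by
          funext y; simp [fillC]
        rw [h]
        exact P.isFoliatedMap_fill ho
      box := e
      box_mem := he
      rad := r
      rad_pos := hr
      ball_subset := hball
      eq_of_mem_ball := huniq
      mapsTo_ball := hmaps
      finite_level := fun v hv ↦ ⟨S v, hSfin v hv, hS v hv⟩ }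

end Data

end Foliation.ConePosition

end Literature.Topology.FourManifolds
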